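import Literature.GroupTheory.CombinatorialGroupTheory.FreeProductFibredTwist
import Literature.GroupTheory.CombinatorialGroupTheory.FreeProductSurfaceSeparation
import Literature.GroupTheory.CombinatorialGroupTheory.PuncturedSurfaceGroupUnrQuotientCoprod
import Mathlib.Data.ZMod.Basic
import HarnessLib

/-!
# Separating levels for the unramified quotient `Γ_{g,r} ↠ Γ_{g,r}/⟨⟨c_j, ε⟩⟩ ≅ Γ_{g₀,0} ∗ Γ_{g₁,0}` ([CombGC] Prop. 1.2 proof p. 9, `Π^unr` clause — discrete side, pulled back to `Γ_{g,r}`)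

Topic `Literature/GroupTheory/CombinatorialGroupTheory`; PROOF-ONLY (0 definitions).  [CombGC] Prop. 1.2,
proof p. 9 [cite: MochizukiCombGC2007, Prop 1.2 proof p.9]: "under the further assumption that `G` is
sturdy … there exists a finite étale `Π^unr_G`-covering `G' → G` whose restriction to `G_{v₂}` is trivial,
but whose restriction to `G_{v₁}` is nontrivial".  At the two-component affine data of abc-iut-f-164
(`Γ = Γ_{g,r}`, handles `i < g₀` and cusps `s ≤ j` on `C₀`, node loop `ε = (c_s⋯c_{r−1})·∏_{i<g₀}[a_i,b_i]`)
the discrete unramified quotient is `θ : Γ ↠ Γ/K`, `K = ⟨⟨ε, c_0, …, c_{r−1}⟩⟩`,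
`Γ/K ≅ Γ_{g₀,0} ∗ Γ_{g₁,0}` (abc-iut-f-166's Tietze theorem `exists_mulEquiv_unrQuotient_coprod`).
This file is the DISCRETE HALF of step (iv) of the door-D1 assembly (sub-DAG row P12-L01-U / FACT row
F-2828): the separating normal subgroups of a finite-index level `N ⊴ Γ`, PULLED BACK TO `Γ` (the
profinite transfer along `ι : Γ → Π` runs at `N = ι⁻¹(V)`, which need not contain `K`):

* `exists_normal_separating_sameFactor` — abstract `K ⊴ Γ`, `ē : A ∗ C ≃* Γ/K`, `H ≤ Γ` with
  `θ(H)` the first factor, `f₁⁻¹ f₂ ∉ H·K·N`: some `U' ⊴ N` of index dividing `|M|` contains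
  `(f₂ H f₂⁻¹ · K) ∩ N` but not `f₁ a₀ f₁⁻¹` — the fibred twist
  (`FreeProductFibredTwist.exists_normal_separating_of_freeProduct`, abc-iut-f-166) at `N̄ = θ(N)`, pulled
  back along `N ↠ N̄`;
* `exists_normal_separating_crossFactor` — the KILLED subgroup maps onto the SECOND factor; all `f₂`
  (the projection `Monoid.Coprod.fst`);
* at `Γ_{g₀+g₁,r}`: `exists_coprod_symm_pinned`, `map_mk_closure_v0_eq_range_inl`,
  `map_mk_closure_v1_eq_range_inr` (the images of the vertex generating sets `⟨a_i, b_i (i<g₀), c_j (s≤j)⟩`,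
  `⟨a_i, b_i (g₀≤i), c_j (j<s), ε⟩` in `Γ/K` are the two factors), the swapped orientation, and the
  witness data `handleWitness_v0/_v1` (`a^m ∈ N`, `m = [Γ : N]`, a character to `ℤ/n` nonzero on it when
  `n ∤ m`).

Consumer: `PSCUnrVerticialSeparatingCoveringsTwoComponentAffine.lean` (abc-iut-w5-d047).  Elementary group
theory (Serre, *Trees* I §5.5 [cite: SerreTrees1980, I §5.5 Thm. 14]); abc-iut-w5-d047 (gen 7).  Nothing
here concerns [IUTchIII] Cor. 3.12.
-/

namespace Literature.GroupTheory.CombinatorialGroupTheory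

open scoped Pointwise
open Monoid (Coprod)

/-! ### Bookkeeping in `Γ ↠ Γ/K` -/

section Bookkeeping

variable {Γ Γ' : Type*} [Group Γ] [Group Γ']

/-- `θ (f H f⁻¹) = θ(f) θ(H) θ(f)⁻¹` (conjugates of vertex groups under the quotient map).
[cite: MochizukiCombGC2007, Def 1.1(ii) p.7] -/
theorem map_toConjAct_smul (θ : Γ →* Γ') (f : Γ) (H : Subgroup Γ) :
    (ConjAct.toConjAct f • H).map θ = ConjAct.toConjAct (θ f) • H.map θ := by
  ext y
  simp only [Subgroup.mem_map, Subgroup.mem_smul_pointwise_iff_exists, ConjAct.smul_def,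
    ConjAct.ofConjAct_toConjAct]
  constructor
  · rintro ⟨x, ⟨h, hh, rfl⟩, rfl⟩
    exact ⟨θ h, ⟨h, hh, rfl⟩, by rw [map_mul, map_mul, map_inv]⟩
  · rintro ⟨_, ⟨h, hh, rfl⟩, rfl⟩
    exact ⟨f * h * f⁻¹, ⟨h, hh, rfl⟩, by rw [map_mul, map_mul, map_inv]⟩

/-- The image of `(f H f⁻¹ · K) ∩ N` in `Γ/K` lies in `θ(f) (θ(H) ∩ θ(N)) θ(f)⁻¹` (a level vertex of the
`Π^unr`-covering read in the unramified quotient). [cite: MochizukiCombGC2007, Def 1.1(ii) p.7] -/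
theorem mk_mem_smul_inf_of_mem (K : Subgroup Γ) [K.Normal] (H N : Subgroup Γ) [hN : N.Normal] (f : Γ)
    {z : Γ} (hz : z ∈ ((ConjAct.toConjAct f • H) ⊔ K) ⊓ N) :
    QuotientGroup.mk' K z ∈ ConjAct.toConjAct (QuotientGroup.mk' K f) •
      (H.map (QuotientGroup.mk' K) ⊓ N.map (QuotientGroup.mk' K)) := by
  have hNb : (N.map (QuotientGroup.mk' K)).Normal := hN.map _ (QuotientGroup.mk'_surjective K)
  rw [Subgroup.smul_inf, Subgroup.Normal.conjAct hNb, ← map_toConjAct_smul]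
  refine ⟨?_, Subgroup.mem_map_of_mem _ hz.2⟩
  have hK : K.map (QuotientGroup.mk' K) = ⊥ :=
    (Subgroup.map_eq_bot_iff _).mpr (le_of_eq (QuotientGroup.ker_mk' K).symm)
  have h1 := Subgroup.mem_map_of_mem (QuotientGroup.mk' K) hz.1
  rwa [Subgroup.map_sup, hK, sup_bot_eq] at h1

/-- `θ(f₁)⁻¹ θ(f₂) ∈ θ(H)·θ(N)` forces `f₁⁻¹ f₂ ∈ H·K·N` (equal level vertices of the `Π^unr`-covering).
[cite: MochizukiCombGC2007, Def 1.1(ii) p.7] -/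
theorem mem_mul_mul_of_mk_mem (K : Subgroup Γ) [hK : K.Normal] (H N : Subgroup Γ) {f₁ f₂ : Γ}
    (h : (QuotientGroup.mk' K f₁)⁻¹ * QuotientGroup.mk' K f₂ ∈
      ((H.map (QuotientGroup.mk' K) : Subgroup (Γ ⧸ K)) : Set (Γ ⧸ K)) *
        ((N.map (QuotientGroup.mk' K) : Subgroup (Γ ⧸ K)) : Set (Γ ⧸ K))) :
    f₁⁻¹ * f₂ ∈ (H : Set Γ) * (K : Set Γ) * (N : Set Γ) := by
  obtain ⟨_, ⟨h', hh', rfl⟩, _, ⟨n, hn, rfl⟩, heq⟩ := Set.mem_mul.mp h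
  rw [← map_inv, ← map_mul, ← map_mul, QuotientGroup.mk'_eq_mk'] at heq
  obtain ⟨k, hk, hk'⟩ := heq
  rw [← hk']
  exact Set.mem_mul.mpr ⟨h' * (n * k * n⁻¹), Set.mem_mul.mpr ⟨h', hh', n * k * n⁻¹, hK.conj_mem k hk n,
    rfl⟩, n, hn, by group⟩

end Bookkeeping

/-! ### The two abstract separating levels -/

section Abstract

variable {Γ A C : Type*} [Group Γ] [Group A] [Group C]

/-- **Same factor (fibred twist pulled back to `Γ`).**  `K ⊴ Γ`, `ē : A ∗ C ≃* Γ/K`, `H ≤ Γ` mapping onto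
the first factor, `N ⊴ Γ`, `ψ` a character of `A` with `ψ α ≠ 1` where `θ a₀ = ē(inl α)`, `a₀ ∈ N`.  If
`f₁⁻¹ f₂ ∉ H·K·N` (two DISTINCT level vertices over the same vertex, read in `Γ/K`), there is `U' ⊴ N`
of index dividing `|M|` with `(f₂ H f₂⁻¹ · K) ∩ N ⊆ U'` and `f₁ a₀ f₁⁻¹ ∉ U'`.
[cite: MochizukiCombGC2007, Prop 1.2 proof p.9] -/
theorem exists_normal_separating_sameFactor (K : Subgroup Γ) [K.Normal] (ē : Coprod A C ≃* Γ ⧸ K)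
    (H : Subgroup Γ)
    (hH : H.map (QuotientGroup.mk' K) = (ē.toMonoidHom.comp (Coprod.inl : A →* Coprod A C)).range)
    (N : Subgroup Γ) [hN : N.Normal] {M : Type*} [CommGroup M] [Finite M] (ψ : A →* M)
    {a₀ : Γ} (ha₀ : a₀ ∈ N) {α : A} (hα : QuotientGroup.mk' K a₀ = ē (Coprod.inl α)) (hψ : ψ α ≠ 1)
    {f₁ f₂ : Γ} (hf : f₁⁻¹ * f₂ ∉ (H : Set Γ) * (K : Set Γ) * (N : Set Γ)) :
    ∃ U' : Subgroup N, U'.Normal ∧ U'.index ∣ Nat.card M ∧ U'.FiniteIndex ∧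
      f₁ * a₀ * f₁⁻¹ ∉ U'.map N.subtype ∧
      ((ConjAct.toConjAct f₂ • H) ⊔ K) ⊓ N ≤ U'.map N.subtype := by
  classical
  set θ := QuotientGroup.mk' K with hθ
  haveI hNbn : (N.map θ).Normal := hN.map θ (QuotientGroup.mk'_surjective K)
  -- the character `φ = ψ ∘ fst ∘ ē⁻¹` on `θ(H) ∩ θ(N)` and the witness `θ a₀`
  let χ : Γ ⧸ K →* M := ψ.comp ((Coprod.fst : Coprod A C →* A).comp ē.symm.toMonoidHom)
  have hχ : ∀ y, χ y = ψ (Coprod.fst (ē.symm y)) := fun y => rfl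
  let φ : ↥(H.map θ ⊓ N.map θ) →* M := χ.comp (H.map θ ⊓ N.map θ).subtype
  have hx₀ : θ a₀ ∈ H.map θ ⊓ N.map θ := ⟨by rw [hH, hα]; exact ⟨α, rfl⟩, Subgroup.mem_map_of_mem θ ha₀⟩
  have hφ : φ ⟨θ a₀, hx₀⟩ ≠ 1 := by
    change χ (θ a₀) ≠ 1
    rw [hχ, hα, MulEquiv.symm_apply_apply, Coprod.fst_apply_inl]
    exact hψ
  obtain ⟨Ub, hUbn, hUbidx, -, hUbnot, hUble⟩ :=
    FreeProductFibredTwist.exists_normal_separating_of_freeProduct ē (H.map θ) hH (N.map θ) φ (θ a₀) hx₀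
      hφ (θ f₁)
  -- pull back along `N ↠ θ(N)`
  let θN : N →* N.map θ := θ.subgroupMap N
  have hθN : ∀ x : N, ((θN x : N.map θ) : Γ ⧸ K) = θ x := fun x => rfl
  have hidx : (Ub.comap θN).index ∣ Nat.card M := by
    rw [Subgroup.index_comap_of_surjective _ (θ.subgroupMap_surjective N)]; exact hUbidx
  refine ⟨Ub.comap θN, inferInstance, hidx, ?_, ?_, ?_⟩
  · exact ⟨fun h0 => (Nat.card_pos (α := M)).ne' (Nat.eq_zero_of_zero_dvd (h0 ▸ hidx))⟩
  · -- `f₁ a₀ f₁⁻¹ ∉ U'`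
    intro hmem
    obtain ⟨n, hn, hn'⟩ := Subgroup.mem_map.mp hmem
    refine hUbnot (Subgroup.mem_map.mpr ⟨θN n, hn, ?_⟩)
    change ((θN n : N.map θ) : Γ ⧸ K) = θ f₁ * θ a₀ * (θ f₁)⁻¹
    rw [hθN, ← map_mul, ← map_inv, ← map_mul]
    exact congrArg θ hn'
  · -- `(f₂ H f₂⁻¹ · K) ∩ N ⊆ U'`
    intro z hz
    have h1 : θ z ∈ ConjAct.toConjAct (θ f₂) • (H.map θ ⊓ N.map θ) := mk_mem_smul_inf_of_mem K H N f₂ hz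
    have h2 : (θ f₁)⁻¹ * θ f₂ ∉ ((H.map θ : Subgroup (Γ ⧸ K)) : Set (Γ ⧸ K)) * (N.map θ : Set (Γ ⧸ K)) :=
      fun hmem => hf (mem_mul_mul_of_mk_mem K H N hmem)
    obtain ⟨u, hu, hu'⟩ := Subgroup.mem_map.mp (hUble (θ f₂) h2 h1)
    refine Subgroup.mem_map.mpr ⟨⟨z, hz.2⟩, ?_, rfl⟩
    change θN ⟨z, hz.2⟩ ∈ Ub
    have h3 : θN ⟨z, hz.2⟩ = u := Subtype.ext (by rw [hθN]; exact hu'.symm)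
    rw [h3]
    exact hu

/-- **Cross factor (projection to the first factor).**  `K ⊴ Γ`, `ē : A ∗ C ≃* Γ/K`, `Hk ≤ Γ` mapping onto
the SECOND factor, `N ⊴ Γ`, `ψ : A → M` with `ψ α ≠ 1`, `θ a₀ = ē(inl α)`: the kernel `U' ⊴ N` of
`ψ ∘ fst ∘ ē⁻¹ ∘ θ` has index dividing `|M|`, contains `(f₂ Hk f₂⁻¹ · K) ∩ N` for EVERY `f₂` (the second
factor dies under `fst`) and not `f₁ a₀ f₁⁻¹`. [cite: MochizukiCombGC2007, Prop 1.2 proof p.9] -/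
theorem exists_normal_separating_crossFactor (K : Subgroup Γ) [K.Normal] (ē : Coprod A C ≃* Γ ⧸ K)
    (Hk : Subgroup Γ)
    (hHk : Hk.map (QuotientGroup.mk' K) = (ē.toMonoidHom.comp (Coprod.inr : C →* Coprod A C)).range)
    (N : Subgroup Γ) [hN : N.Normal] {M : Type*} [CommGroup M] [Finite M] (ψ : A →* M)
    {a₀ : Γ} {α : A} (hα : QuotientGroup.mk' K a₀ = ē (Coprod.inl α)) (hψ : ψ α ≠ 1) (f₁ f₂ : Γ) :
    ∃ U' : Subgroup N, U'.Normal ∧ U'.index ∣ Nat.card M ∧ U'.FiniteIndex ∧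
      f₁ * a₀ * f₁⁻¹ ∉ U'.map N.subtype ∧
      ((ConjAct.toConjAct f₂ • Hk) ⊔ K) ⊓ N ≤ U'.map N.subtype := by
  classical
  set θ := QuotientGroup.mk' K with hθ
  let χ : Γ →* M := ψ.comp (((Coprod.fst : Coprod A C →* A).comp ē.symm.toMonoidHom).comp θ)
  have hχ : ∀ x, χ x = ψ (Coprod.fst (ē.symm (θ x))) := fun x => rfl
  let χN : N →* M := χ.comp N.subtype
  have hidx : χN.ker.index ∣ Nat.card M := by
    rw [Subgroup.index_ker]; exact Subgroup.card_subgroup_dvd_card χN.range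
  refine ⟨χN.ker, inferInstance, hidx, ?_, ?_, ?_⟩
  · exact ⟨fun h0 => (Nat.card_pos (α := M)).ne' (Nat.eq_zero_of_zero_dvd (h0 ▸ hidx))⟩
  · intro hmem
    obtain ⟨n, hn, hn'⟩ := Subgroup.mem_map.mp hmem
    rw [MonoidHom.mem_ker] at hn
    apply hψ
    have h1 : χ (f₁ * a₀ * f₁⁻¹) = ψ α := by
      rw [map_mul, map_mul, map_inv, mul_inv_cancel_comm, hχ, hα, MulEquiv.symm_apply_apply,
        Coprod.fst_apply_inl]
    rw [← h1, ← hn']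
    exact hn
  · intro z hz
    refine Subgroup.mem_map.mpr ⟨⟨z, hz.2⟩, ?_, rfl⟩
    rw [MonoidHom.mem_ker]
    change χ z = 1
    have h1 := mk_mem_smul_inf_of_mem K Hk N f₂ hz
    rw [hHk] at h1
    obtain ⟨y, ⟨⟨cc, hcc⟩, -⟩, hy⟩ := (Subgroup.mem_smul_pointwise_iff_exists _ _ _).mp h1
    rw [ConjAct.smul_def, ConjAct.ofConjAct_toConjAct] at hy
    rw [hχ z, hθ, ← hy, ← hcc]
    simp only [map_mul, map_inv, MonoidHom.coe_comp, Function.comp_apply, MulEquiv.coe_toMonoidHom,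
      MulEquiv.symm_apply_apply, Coprod.fst_apply_inr, mul_one, mul_inv_cancel, map_one]

end Abstract

/-! ### At `Γ_{g₀+g₁,r}`: the Tietze isomorphism and the two vertex groups -/

namespace PuncturedSurfaceGroup

/-- The Tietze isomorphism of abc-iut-f-166 in the orientation `Γ_{g₀,0} ∗ Γ_{g₁,0} ≃* Γ_{g₀+g₁,r}/K`,
`K = ⟨⟨ε, c_j⟩⟩`, with the handle letters pinned, together with the SWAPPED orientation
`Γ_{g₁,0} ∗ Γ_{g₀,0} ≃* Γ/K` (for the vertex `v₁` in the alive role).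
[cite: MochizukiCombGC2007, Def 1.1(ii) p.7] -/
theorem exists_coprod_symm_pinned (g₀ g₁ r s : ℕ) (ε : PuncturedSurfaceGroup (g₀ + g₁) r)
    (hε : ε = ((List.finRange r).map fun j : Fin r => if s ≤ (j : ℕ) then c (g := g₀ + g₁) j else 1).prod *
      ((List.finRange (g₀ + g₁)).map fun i : Fin (g₀ + g₁) => if (i : ℕ) < g₀ then
        a (r := r) i * b i * (a i)⁻¹ * (b i)⁻¹ else 1).prod) :
    ∃ (ē : Coprod (PuncturedSurfaceGroup g₀ 0) (PuncturedSurfaceGroup g₁ 0) ≃*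
        PuncturedSurfaceGroup (g₀ + g₁) r ⧸
          Subgroup.normalClosure ({ε} ∪ Set.range (c : Fin r → PuncturedSurfaceGroup (g₀ + g₁) r)))
      (ē' : Coprod (PuncturedSurfaceGroup g₁ 0) (PuncturedSurfaceGroup g₀ 0) ≃*
        PuncturedSurfaceGroup (g₀ + g₁) r ⧸
          Subgroup.normalClosure ({ε} ∪ Set.range (c : Fin r → PuncturedSurfaceGroup (g₀ + g₁) r))),
      (∀ (i : Fin g₀) (bit : Bool), ē (Coprod.inl (PresentedGroup.of (Sum.inl (i, bit)))) =
        QuotientGroup.mk (PresentedGroup.of (Sum.inl (Fin.castAdd g₁ i, bit)))) ∧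
      (∀ (j : Fin g₁) (bit : Bool), ē (Coprod.inr (PresentedGroup.of (Sum.inl (j, bit)))) =
        QuotientGroup.mk (PresentedGroup.of (Sum.inl (Fin.natAdd g₀ j, bit)))) ∧
      (∀ (j : Fin g₁) (bit : Bool), ē' (Coprod.inl (PresentedGroup.of (Sum.inl (j, bit)))) =
        QuotientGroup.mk (PresentedGroup.of (Sum.inl (Fin.natAdd g₀ j, bit)))) ∧
      (∀ (i : Fin g₀) (bit : Bool), ē' (Coprod.inr (PresentedGroup.of (Sum.inl (i, bit)))) =
        QuotientGroup.mk (PresentedGroup.of (Sum.inl (Fin.castAdd g₁ i, bit)))) := by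
  obtain ⟨_, e, hl, hr⟩ := exists_mulEquiv_unrQuotient_coprod g₀ g₁ r s ε hε
  refine ⟨e.symm, (MulEquiv.coprodComm _ _).trans e.symm,
    fun i bit => (MulEquiv.symm_apply_eq e).mpr (hl i bit).symm,
    fun j bit => (MulEquiv.symm_apply_eq e).mpr (hr j bit).symm, fun j bit => ?_, fun i bit => ?_⟩
  · rw [MulEquiv.trans_apply, MulEquiv.coprodComm_apply, Coprod.swap_inl]
    exact (MulEquiv.symm_apply_eq e).mpr (hr j bit).symm
  · rw [MulEquiv.trans_apply, MulEquiv.coprodComm_apply, Coprod.swap_inr]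
    exact (MulEquiv.symm_apply_eq e).mpr (hl i bit).symm

section Vertex

variable {g₀ g₁ r : ℕ} (s : ℕ) (K : Subgroup (PuncturedSurfaceGroup (g₀ + g₁) r)) [K.Normal]
  {A C : Type*} [Group A] [Group C]

/-- **The `C₀`-side generating set maps onto its factor.**  For ANY `ē : Γ_{g₀,0} ∗ C ≃* Γ_{g₀+g₁,r}/K`
with `ē (inl a_i) = [a_{castAdd i}]`, `ē (inl b_i) = [b_{castAdd i}]` and `K ∋ c_j` normal, the image in
`Γ/K` of `⟨a_i, b_i (i < g₀), c_j (s ≤ j)⟩` (hypothesis `hV₀` of the two-component affine shape) is the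
`inl`-factor; likewise for `ē' : A ∗ Γ_{g₀,0}` and `inr`. [cite: MochizukiCombGC2007, Def 1.1(ii) p.7] -/
theorem map_mk_closure_v0_eq_range (hcK : ∀ j, c j ∈ K) (η : PuncturedSurfaceGroup g₀ 0 →* _ ⧸ K)
    (hpin : ∀ (i : Fin g₀) (bit : Bool), η (PresentedGroup.of (Sum.inl (i, bit))) =
      QuotientGroup.mk (PresentedGroup.of (Sum.inl (Fin.castAdd g₁ i, bit)))) :
    (Subgroup.closure {x : PuncturedSurfaceGroup (g₀ + g₁) r |
        (∃ i : Fin (g₀ + g₁), (i : ℕ) < g₀ ∧ (x = a i ∨ x = b i)) ∨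
          ∃ j : Fin r, s ≤ (j : ℕ) ∧ x = c j}).map (QuotientGroup.mk' K) = η.range := by
  rw [MonoidHom.range_eq_map, ← PresentedGroup.closure_range_of, MonoidHom.map_closure,
    MonoidHom.map_closure]
  apply le_antisymm
  · refine (Subgroup.closure_le _).mpr ?_
    rintro y ⟨x, hx, rfl⟩
    rcases hx with ⟨i, hi, rfl | rfl⟩ | ⟨j, -, rfl⟩
    · refine Subgroup.subset_closure ⟨a ⟨i, hi⟩, ⟨Sum.inl (⟨i, hi⟩, false), rfl⟩, ?_⟩
      change η (PresentedGroup.of (Sum.inl (⟨i, hi⟩, false))) = _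
      rw [hpin, QuotientGroup.mk'_apply]; rfl
    · refine Subgroup.subset_closure ⟨b ⟨i, hi⟩, ⟨Sum.inl (⟨i, hi⟩, true), rfl⟩, ?_⟩
      change η (PresentedGroup.of (Sum.inl (⟨i, hi⟩, true))) = _
      rw [hpin, QuotientGroup.mk'_apply]; rfl
    · rw [QuotientGroup.mk'_apply, (QuotientGroup.eq_one_iff _).mpr (hcK j)]
      exact Subgroup.one_mem _
  · refine (Subgroup.closure_le _).mpr ?_
    rintro y ⟨z, ⟨x, rfl⟩, rfl⟩
    rcases x with ⟨i, bit⟩ | j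
    · refine Subgroup.subset_closure ⟨PresentedGroup.of (Sum.inl (Fin.castAdd g₁ i, bit)), ?_, ?_⟩
      · refine Or.inl ⟨Fin.castAdd g₁ i, by simp, ?_⟩
        cases bit
        · exact Or.inl rfl
        · exact Or.inr rfl
      · rw [QuotientGroup.mk'_apply, ← hpin i bit]
    · exact Fin.elim0 j

/-- **The `C₁`-side generating set maps onto its factor**: for `η : Γ_{g₁,0} → Γ_{g₀+g₁,r}/K` (a factor
embedding) with `η a_j = [a_{natAdd j}]`, `η b_j = [b_{natAdd j}]` and `K ∋ c_j, ε` normal, the image of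
`⟨a_i, b_i (g₀ ≤ i), c_j (j < s), ε⟩` (hypothesis `hV₁`) is the range of `η`.
[cite: MochizukiCombGC2007, Def 1.1(ii) p.7] -/
theorem map_mk_closure_v1_eq_range (hcK : ∀ j, c j ∈ K) {ε : PuncturedSurfaceGroup (g₀ + g₁) r}
    (hεK : ε ∈ K) (η : PuncturedSurfaceGroup g₁ 0 →* _ ⧸ K)
    (hpin : ∀ (j : Fin g₁) (bit : Bool), η (PresentedGroup.of (Sum.inl (j, bit))) =
      QuotientGroup.mk (PresentedGroup.of (Sum.inl (Fin.natAdd g₀ j, bit)))) :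
    (Subgroup.closure {x : PuncturedSurfaceGroup (g₀ + g₁) r |
        (∃ i : Fin (g₀ + g₁), g₀ ≤ (i : ℕ) ∧ (x = a i ∨ x = b i)) ∨
          (∃ j : Fin r, (j : ℕ) < s ∧ x = c j) ∨ x = ε}).map (QuotientGroup.mk' K) = η.range := by
  rw [MonoidHom.range_eq_map, ← PresentedGroup.closure_range_of, MonoidHom.map_closure,
    MonoidHom.map_closure]
  apply le_antisymm
  · refine (Subgroup.closure_le _).mpr ?_
    rintro y ⟨x, hx, rfl⟩
    rcases hx with ⟨i, hi, rfl | rfl⟩ | ⟨j, -, rfl⟩ | rfl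
    · have hi' : (i : ℕ) - g₀ < g₁ := by omega
      have hii : i = Fin.natAdd g₀ ⟨(i : ℕ) - g₀, hi'⟩ := Fin.ext (by simp; omega)
      refine Subgroup.subset_closure ⟨a ⟨(i : ℕ) - g₀, hi'⟩, ⟨Sum.inl (⟨(i : ℕ) - g₀, hi'⟩, false), rfl⟩, ?_⟩
      change η (PresentedGroup.of (Sum.inl (⟨(i : ℕ) - g₀, hi'⟩, false))) = _
      rw [hpin, QuotientGroup.mk'_apply]
      exact congrArg (fun t : Fin (g₀ + g₁) => (QuotientGroup.mk (PresentedGroup.of (Sum.inl (t, false))) :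
        PuncturedSurfaceGroup (g₀ + g₁) r ⧸ K)) hii.symm
    · have hi' : (i : ℕ) - g₀ < g₁ := by omega
      have hii : i = Fin.natAdd g₀ ⟨(i : ℕ) - g₀, hi'⟩ := Fin.ext (by simp; omega)
      refine Subgroup.subset_closure ⟨b ⟨(i : ℕ) - g₀, hi'⟩, ⟨Sum.inl (⟨(i : ℕ) - g₀, hi'⟩, true), rfl⟩, ?_⟩
      change η (PresentedGroup.of (Sum.inl (⟨(i : ℕ) - g₀, hi'⟩, true))) = _
      rw [hpin, QuotientGroup.mk'_apply]
      exact congrArg (fun t : Fin (g₀ + g₁) => (QuotientGroup.mk (PresentedGroup.of (Sum.inl (t, true))) :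
        PuncturedSurfaceGroup (g₀ + g₁) r ⧸ K)) hii.symm
    · rw [QuotientGroup.mk'_apply, (QuotientGroup.eq_one_iff _).mpr (hcK j)]
      exact Subgroup.one_mem _
    · rw [QuotientGroup.mk'_apply, (QuotientGroup.eq_one_iff _).mpr hεK]
      exact Subgroup.one_mem _
  · refine (Subgroup.closure_le _).mpr ?_
    rintro y ⟨z, ⟨x, rfl⟩, rfl⟩
    rcases x with ⟨j, bit⟩ | j
    · refine Subgroup.subset_closure ⟨PresentedGroup.of (Sum.inl (Fin.natAdd g₀ j, bit)), ?_, ?_⟩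
      · refine Or.inl ⟨Fin.natAdd g₀ j, by simp, ?_⟩
        cases bit
        · exact Or.inl rfl
        · exact Or.inr rfl
      · rw [QuotientGroup.mk'_apply, ← hpin j bit]
    · exact Fin.elim0 j

end Vertex

/-! ### The witness: a power of the first alive handle and a character seeing it -/

/-- **Witness for the alive vertex.**  For a normal subgroup `N` of finite index `m` of any group and an
element `a₁`: `a₁^m ∈ N`; and for `n ∤ m` the character `ℤ/n` of `Γ_{g,0}` with all `a_i ↦ 1`, `b_i ↦ 0`
(`exists_handleCharacter_zero`) does not vanish on `a_0^m`. [cite: MochizukiCombGC2007, Prop 1.2 proof p.9] -/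
theorem exists_handleCharacter_pow_ne_one {g : ℕ} (hg : 0 < g) (m n : ℕ) [NeZero n] (hn : ¬ n ∣ m) :
    ∃ ψ : PuncturedSurfaceGroup g 0 →* Multiplicative (ZMod n),
      ψ (a ⟨0, hg⟩ ^ m) ≠ 1 ∧ Nat.card (Multiplicative (ZMod n)) = n := by
  obtain ⟨ψ, hψa, -⟩ := exists_handleCharacter_zero (g := g) (M := Multiplicative (ZMod n))
    (fun _ => Multiplicative.ofAdd 1) (fun _ => 1)
  refine ⟨ψ, ?_, by simp [Nat.card_eq_fintype_card, ZMod.card]⟩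
  rw [map_pow, hψa, ← ofAdd_nsmul, nsmul_eq_mul, mul_one]
  intro h
  have h' : ((m : ZMod n)) = 0 := by
    have := congrArg Multiplicative.toAdd h
    simpa using this
  exact hn ((ZMod.natCast_eq_zero_iff m n).mp h')

end PuncturedSurfaceGroup

end Literature.GroupTheory.CombinatorialGroupTheory
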